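import Mathlib
import HarnessLib
import Literature.NumberTheory.LFunctions.ZetaScrew
import Summits.RiemannHypothesis.RiemannHypothesis.Theorems.IntegerScrewIncrementCovLag

/-!
# Route `IntegerScrew` — the INCREMENT GRAM BRACKETS near the corner and their three limits
# (PIVOT-LAW §15.2–15.3; RH-FREE; no matrix, no pivot — `Ψ` on the wall only)

For the increments `I_{M−k} = x_{log(M−k)} − x_{log(M−k−1)}` of Kreĭn's screw line the Gram brackets are
`B_M(j,k) := Ψ(ℓ_j − ℓ_{k+1}) + Ψ(ℓ_{j+1} − ℓ_k) − Ψ(ℓ_j − ℓ_k) − Ψ(ℓ_{j+1} − ℓ_{k+1})`, `ℓ_a = log(M − a)`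
(`⟨I_{M−j}, I_{M−k}⟩ = B_M(j,k)`; diagonal `2Ψ(h_{M−k})`, row `0` the lag covariances).  This file proves

* `incrementBracket_comm` : `B_M(j,k) = B_M(k,j)` (`Ψ` even);
* `tendsto_mul_incrementBracket` : `M·B_M(j,k) → c_{k−j}/2` for `j < k`
  (`IntegerScrewIncrementCovLag.tendsto_incrementCovLag` at the shifted corner `M − j`);
* `tendsto_mul_incrementBracket_diag_div_log` : `M·B_M(k,k)/log M → 1`;
* `tendsto_mul_incrementBracket_div_log` : `M·B_M(j,k)/log M → 0` for `j ≠ k`.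

These are the analytic inputs of the `K`-node floor (`IntegerScrewKNodeFloor`) and of its sharpness.
Statements about the explicit function `Ψ` on `[0, log 2)`; nothing here bears on the truth of RH.
[Suzuki2023, (1.1)]
-/

noncomputable section

-- D-0017: `Summit.<S>.<S>.…` is the designed namespace of a single-problem summit.
set_option linter.dupNamespace false

namespace Summit.RiemannHypothesis.RiemannHypothesis.Theorems.IntegerScrew

open Literature.NumberTheory.LFunctions Filter Finset
open scoped Topology

/-! ### The increment Gram brackets: symmetry, and their three kinds of limits -/

/-- Eventually (in `M : ℕ`) the real cast exceeds any given real. [folklore] -/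
private theorem eventually_natCast_gt' (c : ℝ) : ∀ᶠ M : ℕ in atTop, c < (M : ℝ) :=
  tendsto_natCast_atTop_atTop.eventually (eventually_gt_atTop c)

/-- `Ψ(x − y) = Ψ(y − x)` (`Ψ` is even). [folklore] -/
theorem zetaScrew_sub_comm (x y : ℝ) : zetaScrew (x - y) = zetaScrew (y - x) := by
  rw [← zetaScrew_neg, neg_sub]

/-- The increment Gram bracket is symmetric in `(j, k)`. [folklore] -/
theorem incrementBracket_comm (M : ℝ) (j k : ℝ) :
    (zetaScrew (Real.log (M - j) - Real.log (M - (k + 1)))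
        + zetaScrew (Real.log (M - (j + 1)) - Real.log (M - k))
        - zetaScrew (Real.log (M - j) - Real.log (M - k))
        - zetaScrew (Real.log (M - (j + 1)) - Real.log (M - (k + 1)))) = (zetaScrew (Real.log (M - k) - Real.log (M - (j + 1)))
        + zetaScrew (Real.log (M - (k + 1)) - Real.log (M - j))
        - zetaScrew (Real.log (M - k) - Real.log (M - j))
        - zetaScrew (Real.log (M - (k + 1)) - Real.log (M - (j + 1)))) := by
  rw [zetaScrew_sub_comm (Real.log (M - k)) (Real.log (M - (j + 1))),
    zetaScrew_sub_comm (Real.log (M - (k + 1))) (Real.log (M - j)),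
    zetaScrew_sub_comm (Real.log (M - k)) (Real.log (M - j)),
    zetaScrew_sub_comm (Real.log (M - (k + 1))) (Real.log (M - (j + 1)))]
  ring

/-- `M/(M − j) → 1`. [folklore] -/
private theorem tendsto_div_sub_natCast (j : ℝ) :
    Tendsto (fun M : ℕ => (M : ℝ) / ((M : ℝ) - j)) atTop (𝓝 1) := by
  have h2 : Tendsto (fun M : ℕ => 1 + j / ((M : ℝ) - j)) atTop (𝓝 (1 + 0)) := by
    refine tendsto_const_nhds.add (tendsto_const_nhds.div_atTop ?_)
    have := tendsto_atTop_add_const_right atTop (-j) tendsto_natCast_atTop_atTop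
    simpa [sub_eq_add_neg] using this
  rw [add_zero] at h2
  refine h2.congr' ?_
  filter_upwards [eventually_natCast_gt' j] with M hM
  have hMj : (M : ℝ) - j ≠ 0 := by linarith
  field_simp
  ring

/-- **Off-diagonal brackets converge:** for `j < k`, `M·B_M(j,k) → c_{k−j}/2` — the lag-`(k−j)`
covariance at the shifted corner `M − j` (`tendsto_incrementCovLag`), times `M/(M−j) → 1`. [folklore] -/
theorem tendsto_mul_incrementBracket {j k : ℕ} (hjk : j < k) :
    Tendsto (fun M : ℕ => (M : ℝ) * (zetaScrew (Real.log ((M : ℝ) - (j : ℝ)) - Real.log ((M : ℝ) - ((k : ℝ) + 1)))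
        + zetaScrew (Real.log ((M : ℝ) - ((j : ℝ) + 1)) - Real.log ((M : ℝ) - (k : ℝ)))
        - zetaScrew (Real.log ((M : ℝ) - (j : ℝ)) - Real.log ((M : ℝ) - (k : ℝ)))
        - zetaScrew (Real.log ((M : ℝ) - ((j : ℝ) + 1)) - Real.log ((M : ℝ) - ((k : ℝ) + 1))))) atTop
      (𝓝 (-((((k - j : ℕ) : ℝ) + 1) * Real.log (((k - j : ℕ) : ℝ) + 1)
            - 2 * ((((k - j : ℕ) : ℝ)) * Real.log ((k - j : ℕ) : ℝ))
            + ((((k - j : ℕ) : ℝ)) - 1) * Real.log ((((k - j : ℕ) : ℝ)) - 1)) / 2)) := by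
  set κ : ℕ := k - j with hκ
  have hκ1 : 1 ≤ κ := by omega
  have hkj : (k : ℝ) = (j : ℝ) + (κ : ℝ) := by
    rw [hκ, Nat.cast_sub hjk.le]; ring
  -- CovLag at the shifted corner N = M − j
  have h1 := (tendsto_incrementCovLag κ hκ1).comp (tendsto_sub_atTop_nat j)
  have h2 := (tendsto_div_sub_natCast (j : ℝ)).mul h1
  rw [one_mul] at h2
  refine h2.congr' ?_
  filter_upwards [eventually_ge_atTop (k + 2)] with M hM
  have hcast : ((M - j : ℕ) : ℝ) = (M : ℝ) - j := by rw [Nat.cast_sub (by omega)]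
  have hMr : ((k : ℝ) + 2) ≤ (M : ℝ) := by exact_mod_cast hM
  have hjle : (j : ℝ) ≤ k := by exact_mod_cast hjk.le
  have hq0 : 0 < (M : ℝ) - j := by linarith
  have hq1 : 0 < (M : ℝ) - (j + 1) := by linarith
  have hqk : 0 < (M : ℝ) - k := by linarith
  have hqk1 : 0 < (M : ℝ) - (k + 1) := by linarith
  simp only [Function.comp_apply]
  rw [hcast]
  have e1 : ((M : ℝ) - j) / ((M : ℝ) - j - ((κ : ℝ) + 1)) = ((M : ℝ) - j) / ((M : ℝ) - (k + 1)) := by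
    rw [hkj]; ring_nf
  have e2 : ((M : ℝ) - j - 1) / ((M : ℝ) - j - κ) = ((M : ℝ) - (j + 1)) / ((M : ℝ) - k) := by
    rw [hkj]; ring_nf
  have e3 : ((M : ℝ) - j) / ((M : ℝ) - j - κ) = ((M : ℝ) - j) / ((M : ℝ) - k) := by
    rw [hkj]; ring_nf
  have e4 : ((M : ℝ) - j - 1) / ((M : ℝ) - j - ((κ : ℝ) + 1)) = ((M : ℝ) - (j + 1)) / ((M : ℝ) - (k + 1)) := by
    rw [hkj]; ring_nf
  rw [e1, e2, e3, e4, Real.log_div hq0.ne' hqk1.ne', Real.log_div hq1.ne' hqk.ne',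
    Real.log_div hq0.ne' hqk.ne', Real.log_div hq1.ne' hqk1.ne']
  have hM0 : ((M : ℝ) - j) ≠ 0 := hq0.ne'
  field_simp

/-- **Diagonal brackets:** `M·B_M(k,k)/log M → 1` (the bracket at `(k,k)` is `2Ψ(h_{M−k})`, the
increment variance; `tendsto_incrementEnergy_shift_div_log`). [folklore] -/
theorem tendsto_mul_incrementBracket_diag_div_log (k : ℕ) :
    Tendsto (fun M : ℕ => (M : ℝ) * (zetaScrew (Real.log ((M : ℝ) - (k : ℝ)) - Real.log ((M : ℝ) - ((k : ℝ) + 1)))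
        + zetaScrew (Real.log ((M : ℝ) - ((k : ℝ) + 1)) - Real.log ((M : ℝ) - (k : ℝ)))
        - zetaScrew (Real.log ((M : ℝ) - (k : ℝ)) - Real.log ((M : ℝ) - (k : ℝ)))
        - zetaScrew (Real.log ((M : ℝ) - ((k : ℝ) + 1)) - Real.log ((M : ℝ) - ((k : ℝ) + 1)))) / Real.log (M : ℝ)) atTop (𝓝 1) := by
  refine (tendsto_incrementEnergy_shift_div_log k).congr' ?_
  filter_upwards [eventually_ge_atTop (k + 2)] with M hM
  have hMr : ((k : ℝ) + 2) ≤ (M : ℝ) := by exact_mod_cast hM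
  have hqk : 0 < (M : ℝ) - k := by linarith
  have hqk1 : 0 < (M : ℝ) - (k + 1) := by linarith
  have e1 : ((M : ℝ) - k) / ((M : ℝ) - k - 1) = ((M : ℝ) - k) / ((M : ℝ) - (k + 1)) := by ring_nf
  rw [e1, Real.log_div hqk.ne' hqk1.ne', sub_self, zetaScrew_zero,
    zetaScrew_sub_comm (Real.log ((M : ℝ) - ((k : ℝ) + 1))) (Real.log ((M : ℝ) - k)),
    show Real.log ((M : ℝ) - ((k : ℝ) + 1)) - Real.log ((M : ℝ) - ((k : ℝ) + 1)) = 0 from sub_self _,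
    zetaScrew_zero]
  ring

/-- **Off-diagonal brackets are `o(log M)`:** for `j ≠ k`, `M·B_M(j,k)/log M → 0`. [folklore] -/
theorem tendsto_mul_incrementBracket_div_log {j k : ℕ} (hjk : j ≠ k) :
    Tendsto (fun M : ℕ => (M : ℝ) * (zetaScrew (Real.log ((M : ℝ) - (j : ℝ)) - Real.log ((M : ℝ) - ((k : ℝ) + 1)))
        + zetaScrew (Real.log ((M : ℝ) - ((j : ℝ) + 1)) - Real.log ((M : ℝ) - (k : ℝ)))
        - zetaScrew (Real.log ((M : ℝ) - (j : ℝ)) - Real.log ((M : ℝ) - (k : ℝ)))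
        - zetaScrew (Real.log ((M : ℝ) - ((j : ℝ) + 1)) - Real.log ((M : ℝ) - ((k : ℝ) + 1)))) / Real.log (M : ℝ)) atTop (𝓝 0) := by
  have hlog : Tendsto (fun M : ℕ => Real.log (M : ℝ)) atTop atTop :=
    Real.tendsto_log_atTop.comp tendsto_natCast_atTop_atTop
  rcases lt_or_gt_of_ne hjk with h | h
  · exact (tendsto_mul_incrementBracket h).div_atTop hlog
  · have h' := (tendsto_mul_incrementBracket h).div_atTop hlog
    refine h'.congr fun M => ?_
    rw [incrementBracket_comm (M : ℝ) (k : ℝ) (j : ℝ)]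

end Summit.RiemannHypothesis.RiemannHypothesis.Theorems.IntegerScrew
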